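import Literature.Computability.Cryptography.LiuPassPadding
import HarnessLib

/-!
# Liu–Pass, Thm 5.6 for the tree's universal machine: the covering family of cond EP-PRGs of Thm 5.2

D-0014 companion (level 3) of `LiuPassCondEPPRG.lean` for the named fact
`Literature.Computability.Cryptography.condEPPRG_family_of_OWFExist` ("what the proof of Thm 5.2 takes
from §5.3 and §2.2": Liu–Pass FOCS 2020, Thm 5.6 + the truncations `G^c` of the proof of Thm 5.2 +
eq. (2), for the tree's abstract efficient universal machine `UniversalMachine`). This file **proves**
that fact from

* `condEPPRG_uniform_of_OWFExist` — Liu–Pass's **Thm 5.5 with its running-time clause** ("there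
  exists a polynomial `t₀` such that for every `γ, δ > 1` … running time bounded by `(γ+δ)t₀(n)`"),
  rendered for the tree as *one* polynomial-time function `Gu` computing the whole family on tagged
  seeds `⟨1^γ, ⟨1^δ, s⟩⟩` (named fact; the tree's `condEPPRG_of_OWFExist` is print's Thm 5.5
  *without* this clause and does not suffice, see "Why uniformity" below);
* `passThrough_polyTime` (proved in the tree, `LiuPassPaddingProofs.lean`);
* two efficiency facts for the maps defined here: `famGen_polyTime` (the padded generators are
  polynomial-time) and `famRedRun_polyTime` (the reduction's distinguisher is polynomial-time).

## The construction (`condEPPRG_family_of_OWFExist_of_facts`)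

Given `Gu`, let `M` be a pass-through machine for `Gu` (`hdr(|w|) ‖ w ‖ σ ↦ Gu(w) ‖ σ` in time
`T(|w|)`), `e, p` its code and simulation overhead on `U`, and `d ≥ 1` with `p(T(x)) ≤ x^d` for large
`x`; put `D = 2d`. Take the member `F = Gu⟨1^{7D}, ⟨1^{3D}, ·⟩⟩` of the family: a `1/n^{3D}`-cond
EP-PRG `{0,1}^n → {0,1}^{n + 7D⌊log₂ n⌋}` with events `E_n` and entropy loss `α₀`. For an outer seed
length `N` let `L = ⌊log₂ N⌋`, `n₁ = 2^{⌊L/D⌋}` (`lpFamIn`, so `n₁^D ≤ N`) and, for `c ≤ 7`,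
`G_c(s) = F(s_{<n₁}) ‖ (s_{≥ n₁})_{< b}` with `b = N + 6L - c - |F(s_{<n₁})|` (`famGen`, `lpFamPad`:
print's `G_γ(s₀ ‖ s₁) = s₀ ‖ G'(s₁)` of Thm 5.6 with the blocks in stack order, the truncation of the
proof of Thm 5.2 being realised by *ignoring* the last seed bits rather than cutting generator output),
`E^c_N = E_{n₁} ‖ {0,1}^{N - n₁}` (`famEv`). Then, for all large `N`:
* `|G_c(s)| = N + 6⌊log₂ N⌋ - c` since `7D⌊L/D⌋ ≥ 6L` (`eventually_famGood`);
* entropy `≥ (n₁ - α₀ log₂ n₁) + b ≥ N - (α₀ + 2) log₂ N` (`mapEntropy_famEv`);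
* `K^t(G_c(s)) + 3L < |G_c(s)|`: the program `e ‖ hdr ‖ ⟨1^{7D},⟨1^{3D}, s_{<n₁}⟩⟩ ‖ pad` has length
  `|G_c(s)| - 7D⌊L/D⌋ + 2 log₂ n₁ + O(1)` and runs within `p(T(n₁ + O(1))) ≤ n₁^{2d} ≤ N ≤ t(|G_c(s)|)`
  steps (`UniversalMachine.exists_ktAt_le_of_outputsWithin`) — print's eq. (2);
* `1/N²`-pseudorandomness by reduction to `F` at the inner length (`famGen_pseudorandom`): a PPT `Dg`
  with advantage `≥ 1/N²` at infinitely many `N` yields the PPT `R` (`famRedDist`: pad the inner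
  sample with fresh coins, run `Dg` at the outer length; *which* of the `< (2n₁)^D` outer lengths
  sharing the inner length `n₁`, and how many coins `Dg` takes there, is advice carried by `R`'s coin
  count, exactly as for `lpAdvDist` in `LiuPassPadding.lean`) with the same advantage
  (`distAdvantage_famRedDist_eq`) `≥ 1/N² > 1/n₁^{3D}` since `N < (2n₁)^D`.

## Why uniformity (deviation from the tree's Thm 5.5 fact)

The budget `t(m) ≥ (1+ε)m ≈ N` must pay for `U`'s simulation of the machine computing the inner
generator, `p(T(n₁)) ≤ N`, forcing `n₁ ≤ N^{1/D}` with `D = deg p · deg T`; the statement then needs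
inner stretch `γ₀⌊log₂ n₁⌋ ≥ 6⌊log₂ N⌋` (`γ₀ ≳ 6D`) and inner security `1/n₁^{δ₀} ≤ 1/N²` (`δ₀ ≳ 2D`).
For the tree's `condEPPRG_of_OWFExist` (for each `γ, δ` *some* polynomial-time generator) `D` depends
on `(γ₀, δ₀)` — through the running time and, `U.sim` being per machine, through the overhead `p` —
and the choice is circular; print breaks the circle with the clause "running time `(γ+δ)t₀(n)`" of
Thm 5.5 (proof of Thm 5.6: "`γ' = 2c₀γ`, `δ' = 4c₀`" with `c₀` from `t₀`), and for an abstract `U`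
with machine-dependent overhead the clause must be realised by a **single** machine taking `γ, δ` as
inputs, which is `condEPPRG_uniform_of_OWFExist`. (Generic stretch amplification is unavailable for
*conditionally* secure generators: iteration leaves the conditioning event, and the hybrid argument
for parallel repetition needs efficiently constructible ensembles — Goldreich, Thm 3.2.6 and the
"advanced comment" closing §3.2.3 — which `G(U_n | E_n)` is not.)

## Deviations from print (all documented at the declarations)

1. Block order `G'(s₁) ‖ s₀` (stack discipline of `passThrough_polyTime`), inner seed first.
2. The inner seed length is `2^{⌊⌊log₂ N⌋/D⌋}` (print: `N^{1/2c₀}`), making `⌊log₂ n₁⌋ = ⌊L/D⌋` exact;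
   the stretch is fixed to `γ = 6` (print: every `γ > 1`; the fact asks for one `γ ≥ 2`), inner
   parameters `γ₀ = 7D`, `δ₀ = 3D`, entropy loss `α₀ + 2`.
3. Exact output length `N + 6⌊log₂ N⌋ - c` is obtained by dropping `≤ 7D + L` seed bits from the
   pass-through block (entropy cost `≤ log₂ N + O(1)`), not by truncating `G'`'s output.
4. Advice through the coin count in the reduction (as in `LiuPassPadding.lean`, Deviation 2).

Theorem numbering follows arXiv:2009.11514v1 (§5.1 Def 5.1, §5.2 Thm 5.2, §5.3 Thms 5.5–5.6).

## References

* Y. Liu, R. Pass, *On one-way functions and Kolmogorov complexity*, FOCS 2020, 1243–1254;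
  arXiv:2009.11514, §2.2, §5.2 (proof of Thm 5.2, ¶1 and eq. (2)), §5.3 (Thm 5.5 and its proof,
  last paragraph: the running-time clause; Thm 5.6 and its proof). doi:10.1109/FOCS46700.2020.00118
* O. Goldreich, *Foundations of Cryptography I*, CUP 2001 (repr. 2004), §3.2.3, Thm 3.2.6 and the
  advanced comment following the hybrid technique ("the conclusion may fail in case the individual
  ensembles are not both efficiently constructible").
* T. M. Cover, J. A. Thomas, *Elements of Information Theory*, 2nd ed., Wiley 2006, (2.14).
-/

namespace Literature.Computability.Cryptography

open Filter _root_.Computability Complexity MetaComplexity Finset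
open scoped ENNReal

/-! ### Thm 5.5 with its running-time clause: one machine for the whole family -/

section UniformFact

/-- The member `(γ, δ)` of a uniformly computed family of generators: the seed is tagged with the
stretch parameter `γ` and the security parameter `δ` in unary, `s ↦ Gu ⟨1^γ, ⟨1^δ, s⟩⟩`
(`boolPair`/`unaryEncodeNat`). [Y. Liu, R. Pass, FOCS 2020, proof of Thm 5.5 (last paragraph: one
algorithm for all `γ, δ`)] [cite: LiuPassFOCS2020, Thm 5.5 (proof)] -/
def lpTagged (Gu : List Bool → List Bool) (γ δ : ℕ) (s : List Bool) : List Bool :=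
  Gu (boolPair (unaryEncodeNat γ) (boolPair (unaryEncodeNat δ) s))

/-- **Liu–Pass 2020, Thm 5.5 with its running-time clause (cond EP-PRGs from OWFs, uniformly in
the parameters)**, named fact (D-0014). Print: "Assume that one way functions exist. Then, there
exists a polynomial `t₀(·)` such that for every `γ > 1, δ > 1`, there exists a `(1/n^δ)`-condEP-PRG
`G'_{δ,γ} : {0,1}^n → {0,1}^{n + γ log n}` with running time bounded by `(γ + δ) t₀(n)`", the clause
being proved by exhibiting *one* algorithm ("the OWF used in this construction can be assumed to have
some fixed polynomial running time … for any `γ, δ`, `G'` runs in `poly(n) + O(n^{c+1}) +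
(γ+δ) O(n^c log n) ≤ (γ+δ) t₀(n')` time"). Rendering for the tree (where running time is a property
of a TM2 machine and the universal machine's simulation overhead is machine-dependent,
`UniversalMachine.sim`): there is a single polynomial-time `Gu : {0,1}* → {0,1}*` such that for all
natural `γ, δ > 1` the member `s ↦ Gu⟨1^γ, ⟨1^δ, s⟩⟩` (`lpTagged`) is a `1/n^δ`-cond EP-PRG of
output length `n + γ⌊log₂ n⌋` (`lpInner`) in the sense of Def 5.1 as vendored (`IsCondEPPRG`), for
some events and entropy-loss constant depending on `γ, δ`. This strengthens the tree's
`condEPPRG_of_OWFExist` (Thm 5.5 without the clause, `condEPPRG_of_OWFExist_of_uniform`) by exactly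
the uniformity that the proof of Thm 5.6 uses ("let `c₀` be a constant such that `O(n^{c₀}) ≥ t₀(n)`
… `γ' = 2c₀γ` and `δ' = 4c₀`"). Not proved here: it is the construction of §5.3 (Lemmas 5.3–5.4,
proof of Thm 5.5: `G_{δ,γ}(i, x, σ₁, σ₂, σ_GL) = f'_i(x, σ₁, σ₂, σ_GL) ‖ GL(x, σ₁, σ₂, σ_GL)` with
`α' = 8cδ` hash-truncation and `γ' = (c+1)γ + 2α' + 3` Goldreich–Levin bits, extended to all input
lengths) computed by one machine reading `γ, δ` from its input; the tree proves the per-parameter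
version modulo the Goldreich–Levin theorem (`condEPPRG_of_OWFExist_of_GL`,
`LiuPassLemma53Assembly.lean`). [Y. Liu, R. Pass, FOCS 2020, Thm 5.5 and its proof (last
paragraph); arXiv:2009.11514v1, §5.3] [cite: LiuPassFOCS2020, Thm 5.5 (with the running-time clause, as established in its proof)] -/
def condEPPRG_uniform_of_OWFExist : Prop :=
  OWFExist → ∃ Gu : List Bool → List Bool, PolyTimeComputable id id Gu ∧
    ∀ γ δ : ℕ, 1 < γ → 1 < δ → ∃ (E : ℕ → Finset (List Bool)) (α : ℕ),
      IsCondEPPRG (fun n : ℕ => 1 / (n : ℝ) ^ δ) (lpTagged Gu γ δ) E (lpInner γ) α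

/-- The uniform form of Thm 5.5 implies the tree's form without the running-time clause
(`condEPPRG_of_OWFExist`). [Y. Liu, R. Pass, FOCS 2020, Thm 5.5] [cite: LiuPassFOCS2020, Thm 5.5] -/
theorem condEPPRG_of_OWFExist_of_uniform (h : condEPPRG_uniform_of_OWFExist) : condEPPRG_of_OWFExist := by
  intro hO γ δ hγ hδ
  obtain ⟨Gu, _, hfam⟩ := h hO
  obtain ⟨E, α, hG⟩ := hfam γ δ hγ hδ
  exact ⟨_, E, α, hG⟩

end UniformFact

/-! ### Parameters of the family -/

section Params

/-- The inner seed length used at outer seed length `N`: `2^{⌊⌊log₂ N⌋ / D⌋}` (capped by `N`, which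
only matters at `N = 0`). Print (proof of Thm 5.6): `|s₁| = n^{1/2c₀}`; the power of two makes
`⌊log₂ n₁⌋ = ⌊⌊log₂ N⌋/D⌋` exact and `n₁^D ≤ N`. [Y. Liu, R. Pass, FOCS 2020, proof of Thm 5.6]
[cite: LiuPassFOCS2020, Thm 5.6 (proof)] -/
def lpFamIn (D N : ℕ) : ℕ := min N (2 ^ (Nat.log 2 N / D))

/-- The output length `N + 6⌊log₂ N⌋ - c` of the member `c` of the family (print: `m(n) =
n + γ log n - c`, here `γ = 6`). [Y. Liu, R. Pass, FOCS 2020, proof of Thm 5.2 (¶1)]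
[cite: LiuPassFOCS2020, Thm 5.2 (proof, ¶1)] -/
def lpFamLen (c N : ℕ) : ℕ := N + 6 * Nat.log 2 N - c

/-- The length of the pass-through block: `N + 6⌊log₂ N⌋ - c - |F(s₁)|`, `|F(s₁)| = n₁ + γ₀⌊log₂ n₁⌋`.
[Y. Liu, R. Pass, FOCS 2020, proofs of Thm 5.6 and Thm 5.2 (¶1)] [cite: LiuPassFOCS2020, Thm 5.6 (proof)] -/
def lpFamPad (γ₀ D c N : ℕ) : ℕ := lpFamLen c N - lpInner γ₀ (lpFamIn D N)

/-- **The member `c` of the covering family** built from the inner generator `F`: on a seed `s` of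
length `N`, apply `F` to the first `n₁ = lpFamIn D N` bits and pass the next `lpFamPad γ₀ D c N` bits
through, `G_c(s) = F(s_{< n₁}) ‖ (s_{≥ n₁})_{< b}` (print: `G_γ(s₀ ‖ s₁) = s₀ ‖ G'(s₁)` and "`G^c`
computes `G'` and truncates the last `c` bits"; here the surplus seed bits are ignored instead).
[Y. Liu, R. Pass, FOCS 2020, proof of Thm 5.6; proof of Thm 5.2 (¶1)] [cite: LiuPassFOCS2020, Thm 5.6 (proof)] -/
def famGen (F : List Bool → List Bool) (γ₀ D c : ℕ) (s : List Bool) : List Bool :=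
  F (s.take (lpFamIn D s.length)) ++ (s.drop (lpFamIn D s.length)).take (lpFamPad γ₀ D c s.length)

/-- The conditioning events of the family: `E^c_N = E_{n₁} ‖ {0,1}^{N - n₁}` (the inner event on the
inner seed, no condition on the pass-through block). [Y. Liu, R. Pass, FOCS 2020, proof of Thm 5.6
("the entropy-loss of `G_γ` is `α' log(n^{1/2c₀})`")] [cite: LiuPassFOCS2020, Thm 5.6 (proof)] -/
def famEv (E : ℕ → Finset (List Bool)) (D N : ℕ) : Finset (List Bool) :=
  padSeeds (E (lpFamIn D N)) (N - lpFamIn D N)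

/-- `lpFamIn D N ≤ N`. [folklore] -/
theorem lpFamIn_le (D N : ℕ) : lpFamIn D N ≤ N := min_le_left _ _

/-- For `N ≥ 1` the cap is inactive: `lpFamIn D N = 2^{⌊⌊log₂ N⌋/D⌋}`. [folklore] -/
theorem lpFamIn_eq_pow {D N : ℕ} (hN : N ≠ 0) : lpFamIn D N = 2 ^ (Nat.log 2 N / D) := by
  refine min_eq_right ?_
  calc 2 ^ (Nat.log 2 N / D) ≤ 2 ^ Nat.log 2 N := Nat.pow_le_pow_right two_pos (Nat.div_le_self _ _)
    _ ≤ N := Nat.pow_log_le_self 2 hN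

/-- `⌊log₂ n₁⌋ = ⌊⌊log₂ N⌋ / D⌋`. [folklore] -/
theorem log_lpFamIn {D N : ℕ} (hN : N ≠ 0) : Nat.log 2 (lpFamIn D N) = Nat.log 2 N / D := by
  rw [lpFamIn_eq_pow hN, Nat.log_pow one_lt_two]

/-- `n₁^D ≤ N` for `N ≥ 1`. [folklore] -/
theorem lpFamIn_pow_le {D N : ℕ} (hN : N ≠ 0) : lpFamIn D N ^ D ≤ N := by
  rw [lpFamIn_eq_pow hN, ← pow_mul, mul_comm]
  calc 2 ^ (D * (Nat.log 2 N / D)) ≤ 2 ^ Nat.log 2 N := Nat.pow_le_pow_right two_pos (Nat.mul_div_le _ _)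
    _ ≤ N := Nat.pow_log_le_self 2 hN

/-- `1 ≤ n₁` for `N ≥ 1`. [folklore] -/
theorem one_le_lpFamIn {D N : ℕ} (hN : N ≠ 0) : 1 ≤ lpFamIn D N := by
  rw [lpFamIn_eq_pow hN]; exact Nat.one_le_two_pow

/-- The outer lengths sharing the inner length `n₁ = 2^j` are those with `⌊⌊log₂ N⌋/D⌋ = j`; in
particular `N < (2n₁)^D` (for `D ≥ 1`). [folklore] -/
theorem lt_two_mul_lpFamIn_pow {D N : ℕ} (hD : 1 ≤ D) (hN : N ≠ 0) : N < (2 * lpFamIn D N) ^ D := by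
  rw [lpFamIn_eq_pow hN, ← pow_succ', ← pow_mul]
  calc N < 2 ^ (Nat.log 2 N + 1) := Nat.lt_pow_succ_log_self one_lt_two N
    _ ≤ 2 ^ ((Nat.log 2 N / D + 1) * D) := Nat.pow_le_pow_right two_pos (by
        rw [Nat.add_mul, one_mul]
        exact Nat.succ_le_of_lt (Nat.lt_div_mul_add hD))

/-- The inner length determined by an outer length in the block of `n = 2^j`: if `n^D ≤ N < (2n)^D`
with `n` a power of two then `lpFamIn D N = n`. [folklore] -/
theorem lpFamIn_eq_of_mem_block {D j N : ℕ} (hD : 1 ≤ D) (hlo : (2 ^ j) ^ D ≤ N) (hhi : N < (2 * 2 ^ j) ^ D) :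
    lpFamIn D N = 2 ^ j := by
  have hN : N ≠ 0 := by
    intro h; rw [h] at hlo
    exact absurd hlo (not_le.2 (by positivity))
  rw [lpFamIn_eq_pow hN]
  congr 1
  rw [← pow_mul] at hlo
  rw [← pow_succ', ← pow_mul] at hhi
  have h1 : j * D ≤ Nat.log 2 N := Nat.le_log_of_pow_le one_lt_two hlo
  have h2 : Nat.log 2 N < (j + 1) * D := Nat.log_lt_of_lt_pow hN hhi
  refine le_antisymm ?_ ?_
  · exact Nat.lt_succ_iff.1 ((Nat.div_lt_iff_lt_mul (by omega)).2 h2)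
  · exact (Nat.le_div_iff_mul_le (by omega)).2 h1

/-- The inner length grows with the outer length: `n₀ ≤ lpFamIn D N` once `N ≥ 2^{D n₀}` (`D ≥ 1`).
[folklore] -/
theorem le_lpFamIn_of_pow_le {D n₀ N : ℕ} (hD : 1 ≤ D) (hN : 2 ^ (D * n₀) ≤ N) : n₀ ≤ lpFamIn D N := by
  have hN0 : N ≠ 0 := by intro h; rw [h] at hN; exact absurd hN (not_le.2 (by positivity))
  rw [lpFamIn_eq_pow hN0]
  have hlog : D * n₀ ≤ Nat.log 2 N := Nat.le_log_of_pow_le one_lt_two hN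
  calc n₀ ≤ 2 ^ n₀ := n₀.lt_two_pow_self.le
    _ ≤ 2 ^ (Nat.log 2 N / D) := Nat.pow_le_pow_right two_pos ((Nat.le_div_iff_mul_le (by omega)).2 (by
        rw [mul_comm]; exact hlog))

/-- The inner length tends to infinity with the outer length: `n₀ ≤ lpFamIn D N` for all large `N`
(`D ≥ 1`). [folklore] -/
theorem eventually_le_lpFamIn {D : ℕ} (hD : 1 ≤ D) (n₀ : ℕ) : ∀ᶠ N in atTop, n₀ ≤ lpFamIn D N := by
  filter_upwards [eventually_ge_atTop (2 ^ (D * n₀))] with N hN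
  exact le_lpFamIn_of_pow_le hD hN

/-- `⌊log₂ N⌋` tends to infinity: `k ≤ ⌊log₂ N⌋` for all large `N`. [folklore] -/
theorem eventually_le_log (k : ℕ) : ∀ᶠ N in atTop, k ≤ Nat.log 2 N := by
  filter_upwards [eventually_ge_atTop (2 ^ k)] with N hN
  exact Nat.le_log_of_pow_le one_lt_two hN

/-- **The lengths fit for all large `N`** (with `γ₀ = 7D`, `D ≥ 2`): the inner stretch
`7D⌊⌊log₂ N⌋/D⌋` exceeds the outer stretch `6⌊log₂ N⌋`, the inner output fits into the outer
length, so that `|F(s₁)| + b = N + 6⌊log₂ N⌋ - c` exactly and the pass-through block fits into the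
seed, `b ≤ N - n₁`. [Y. Liu, R. Pass, FOCS 2020, proof of Thm 5.6 ("`G_γ` is `(γ log n)`-bit
expanding")] [cite: LiuPassFOCS2020, Thm 5.6 (proof)] -/
theorem eventually_famGood {D : ℕ} (hD : 2 ≤ D) (c : ℕ) :
    ∀ᶠ N in atTop, lpInner (7 * D) (lpFamIn D N) + lpFamPad (7 * D) D c N = lpFamLen c N ∧
      lpFamPad (7 * D) D c N ≤ N - lpFamIn D N ∧
      6 * Nat.log 2 N ≤ 7 * D * (Nat.log 2 N / D) ∧ c ≤ Nat.log 2 N := by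
  filter_upwards [eventually_le_log (7 * D + c), eventually_le_lpFamIn (D := D) (by omega) (7 * D + 2),
    eventually_ge_atTop 1] with N hL hn₁ hN1
  have hN0 : N ≠ 0 := by omega
  set L := Nat.log 2 N with hLdef
  set n := lpFamIn D N with hn
  have hj : Nat.log 2 n = L / D := log_lpFamIn hN0
  -- `7 D ⌊L/D⌋ ≥ 7 (L - D + 1) ≥ 6 L`
  have hdiv : L < D * (L / D) + D := by
    rw [mul_comm]
    exact Nat.lt_div_mul_add (show 0 < D by omega)
  have hstretch : 6 * L ≤ 7 * D * (L / D) := by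
    have : 7 * D * (L / D) = 7 * (D * (L / D)) := by ring
    rw [this]
    omega
  -- the inner output fits: `n + 7D j ≤ n · n ≤ N`
  have hjle : L / D ≤ n := by
    rw [← hj]; exact (Nat.log_le_self 2 n)
  have hsq : n * n ≤ N := by
    calc n * n = n ^ 2 := (sq n).symm
      _ ≤ n ^ D := Nat.pow_le_pow_right (by omega) hD
      _ ≤ N := lpFamIn_pow_le hN0
  have hinner : lpInner (7 * D) n ≤ N := by
    simp only [lpInner, hj]
    calc n + 7 * D * (L / D) ≤ n + 7 * D * n := Nat.add_le_add_left (Nat.mul_le_mul_left _ hjle) _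
      _ = (7 * D + 1) * n := by ring
      _ ≤ n * n := Nat.mul_le_mul_right _ (by omega)
      _ ≤ N := hsq
  simp only [lpFamPad, lpFamLen, lpInner, hj, ← hn, ← hLdef] at hinner ⊢
  omega

end Params

/-! ### The generator on padded seeds, its events and its entropy -/

section Entropy

variable {S : Finset (List Bool)} {n : ℕ}

/-- On a seed `s ‖ σ` with `|s| = n₁(N)`, `|σ| = N - n₁(N)`: `G_c(s ‖ σ) = F(s) ‖ σ_{< b}`. [folklore] -/
theorem famGen_append (F : List Bool → List Bool) {γ₀ D c N : ℕ} {s σ : List Bool}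
    (hs : s.length = lpFamIn D N) (hσ : σ.length = N - lpFamIn D N) :
    famGen F γ₀ D c (s ++ σ) = F s ++ σ.take (lpFamPad γ₀ D c N) := by
  have hlen : (s ++ σ).length = N := by
    rw [List.length_append, hs, hσ]; have := lpFamIn_le D N; omega
  simp [famGen, hlen, ← hs, List.take_left', List.drop_left']

/-- The events of the family are nonempty. [folklore] -/
theorem famEv_nonempty {E : ℕ → Finset (List Bool)} (hE : ∀ n, (E n).Nonempty) (D N : ℕ) :
    (famEv E D N).Nonempty :=
  padSeeds_nonempty (hE _) _

/-- The events of the family consist of `N`-bit strings. [folklore] -/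
theorem length_of_mem_famEv {E : ℕ → Finset (List Bool)} (hE : ∀ n, ∀ s ∈ E n, s.length = n) {D N : ℕ}
    {x : List Bool} (hx : x ∈ famEv E D N) : x.length = N := by
  have h := length_of_mem_padSeeds (hE _) hx
  have := lpFamIn_le D N
  omega

/-- `mapEntropy` only depends on the values of the map on the set (private copy of the lemma of the
same name in `LiuPassCondFromRegular.lean`, which is not in this file's import closure). [folklore] -/
private theorem mapEntropy_congr_fam {ι β : Type*} [DecidableEq β] {T : Finset ι} {f g : ι → β}
    (h : ∀ x ∈ T, f x = g x) : mapEntropy T f = mapEntropy T g := by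
  unfold mapEntropy
  congr 1
  refine Finset.sum_congr rfl fun v hv => ?_
  have hfib : fiber T f (f v) = fiber T g (g v) := by
    ext w
    simp only [mem_fiber]
    constructor
    · rintro ⟨hw, hfw⟩; exact ⟨hw, by rw [← h w hw, hfw, h v hv]⟩
    · rintro ⟨hw, hgw⟩; exact ⟨hw, by rw [h w hw, hgw, ← h v hv]⟩
  rw [hfib]

/-- The padded generator with a truncated pass-through block, `x ↦ F(x_{< n}) ‖ (x_{≥ n})_{< b}`.
[Y. Liu, R. Pass, FOCS 2020, proof of Thm 5.6] [cite: LiuPassFOCS2020, Thm 5.6 (proof)] -/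
def padGenT (F : List Bool → List Bool) (n b : ℕ) (x : List Bool) : List Bool :=
  F (x.take n) ++ (x.drop n).take b

/-- The truncated padded generator on a padded seed. [folklore] -/
theorem padGenT_append (F : List Bool → List Bool) {s : List Bool} (hs : s.length = n) (b : ℕ) (τ : List Bool) :
    padGenT F n b (s ++ τ) = F s ++ τ.take b := by
  simp [padGenT, List.take_left' hs, List.drop_left' hs]

/-- Fibres of the truncated padded generator: the fibre through `s ‖ τ` consists of the `s' ‖ τ'` with
`F s' = F s` and `τ'_{<b} = τ_{<b}`, so it has `|fibre of F through s| · 2^{B - b}` elements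
(`b ≤ B`). [folklore] -/
theorem card_fiber_padGenT (hSlen : ∀ s ∈ S, s.length = n) (F : List Bool → List Bool) {ℓ : ℕ}
    (hFlen : ∀ s ∈ S, (F s).length = ℓ) {B b : ℕ} (hb : b ≤ B) {s : List Bool} (hs : s ∈ S)
    (τ : List.Vector Bool B) :
    (fiber (padSeeds S B) (padGenT F n b) (padGenT F n b (s ++ τ.toList))).card =
      (fiber S F (F s)).card * 2 ^ (B - b) := by
  classical
  -- the fibre as an injective image of `(fibre of F) × {0,1}^{B-b}`
  set φ : List Bool × List.Vector Bool (B - b) → List Bool := fun q => q.1 ++ (τ.toList.take b ++ q.2.toList) with hφ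
  have himage : fiber (padSeeds S B) (padGenT F n b) (padGenT F n b (s ++ τ.toList)) =
      ((fiber S F (F s)) ×ˢ (Finset.univ : Finset (List.Vector Bool (B - b)))).image φ := by
    ext x
    simp only [mem_fiber, Finset.mem_image, Finset.mem_product, Finset.mem_univ, and_true, mem_padSeeds,
      Prod.exists, hφ]
    constructor
    · rintro ⟨⟨s', hs', τ', hτ', rfl⟩, hG⟩
      rw [padGenT_append F (hSlen s' hs'), padGenT_append F (hSlen s hs)] at hG
      have hl : (F s').length = (F s).length := by rw [hFlen s' hs', hFlen s hs]
      obtain ⟨hF, hτ⟩ := List.append_inj hG hl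
      refine ⟨s', ⟨τ'.drop b, by simp [hτ']⟩, ⟨hs', hF⟩, ?_⟩
      show s' ++ (τ.toList.take b ++ τ'.drop b) = s' ++ τ'
      rw [← hτ, List.take_append_drop]
    · rintro ⟨s', ρ, ⟨hs', hF⟩, rfl⟩
      have hτb : (τ.toList.take b).length = b := by simp [hb]
      refine ⟨⟨s', hs', τ.toList.take b ++ ρ.toList, by simp [hb], rfl⟩, ?_⟩
      rw [padGenT_append F (hSlen s' hs'), padGenT_append F (hSlen s hs), hF, List.take_left' hτb]
  have hinj : Set.InjOn φ ↑((fiber S F (F s)) ×ˢ (Finset.univ : Finset (List.Vector Bool (B - b)))) := by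
    rintro ⟨s₁, ρ₁⟩ h₁ ⟨s₂, ρ₂⟩ h₂ h
    simp only [Finset.coe_product, Finset.coe_univ, Set.mem_prod, Finset.mem_coe, Set.mem_univ, and_true,
      mem_fiber] at h₁ h₂
    have hl : s₁.length = s₂.length := by rw [hSlen s₁ h₁.1, hSlen s₂ h₂.1]
    obtain ⟨rfl, h'⟩ := List.append_inj (show φ (s₁, ρ₁) = φ (s₂, ρ₂) from h) hl
    have h'' := List.append_cancel_left h'
    simp only [Prod.mk.injEq, true_and]
    exact List.Vector.toList_injective h''
  rw [himage, Finset.card_image_of_injOn hinj, Finset.card_product, Finset.card_univ, card_vector,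
    Fintype.card_bool]

/-- **Entropy of the padded generator with a truncated pass-through block**:
`H(x ↦ F(x_{<n}) ‖ (x_{≥n})_{<b}` on `S ‖ {0,1}^B) = H(F(U_S)) + b` for `b ≤ B` — the `b` passed bits
add their length, the `B - b` ignored bits cost nothing. [Y. Liu, R. Pass, FOCS 2020, proof of Thm 5.6
("the entropy-loss of `G_γ` is `α' log(n^{1/2c₀})`"); Cover–Thomas (2.14)] [cite: LiuPassFOCS2020, Thm 5.6 (proof)] -/
theorem mapEntropy_padGenT (hS : S.Nonempty) (hSlen : ∀ s ∈ S, s.length = n)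
    (F : List Bool → List Bool) {ℓ : ℕ} (hFlen : ∀ s ∈ S, (F s).length = ℓ) {B b : ℕ} (hb : b ≤ B) :
    mapEntropy (padSeeds S B) (padGenT F n b) = mapEntropy S F + b := by
  classical
  have hSpos : (0 : ℝ) < S.card := by exact_mod_cast hS.card_pos
  have h2B : (0 : ℝ) < 2 ^ B := by positivity
  have h2Bb : (0 : ℝ) < 2 ^ (B - b) := by positivity
  unfold mapEntropy
  rw [card_padSeeds hSlen B, sum_padSeeds hSlen B]
  have hterm : ∀ s ∈ S, ∀ τ : List.Vector Bool B,
      Real.logb 2 (((S.card * 2 ^ B : ℕ) : ℝ) /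
        (fiber (padSeeds S B) (padGenT F n b) (padGenT F n b (s ++ τ.toList))).card) =
      Real.logb 2 ((S.card : ℝ) / (fiber S F (F s)).card) + b := by
    intro s hs τ
    rw [card_fiber_padGenT hSlen F hFlen hb hs τ]
    have hFpos : (0 : ℝ) < (fiber S F (F s)).card := by exact_mod_cast card_fiber_pos F hs
    have hsplit : ((2 : ℝ) ^ B) = 2 ^ b * 2 ^ (B - b) := by rw [← pow_add]; congr 1; omega
    push_cast
    rw [hsplit, show (S.card : ℝ) * (2 ^ b * 2 ^ (B - b)) / ((fiber S F (F s)).card * 2 ^ (B - b)) =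
        (S.card : ℝ) / (fiber S F (F s)).card * 2 ^ b by field_simp,
      Real.logb_mul (div_pos hSpos hFpos).ne' (by positivity), Real.logb_pow,
      Real.logb_self_eq_one one_lt_two, mul_one]
  rw [Finset.sum_congr rfl fun s hs => Finset.sum_congr rfl fun τ _ => hterm s hs τ]
  simp only [Finset.sum_const, Finset.card_univ, card_vector, Fintype.card_bool, nsmul_eq_mul]
  rw [← Finset.mul_sum, Finset.sum_add_distrib, Finset.sum_const, nsmul_eq_mul]
  push_cast
  field_simp

/-- On the events of the family the generator is the truncated padded generator of the inner length.
[folklore] -/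
theorem famGen_eq_padGenT (F : List Bool → List Bool) {γ₀ D c N : ℕ} {x : List Bool} (hx : x.length = N) :
    famGen F γ₀ D c x = padGenT F (lpFamIn D N) (lpFamPad γ₀ D c N) x := by
  simp [famGen, padGenT, hx]

/-- **Entropy of the family**: `H(G_c(U | E^c_N)) = H(F(U | E_{n₁})) + b`. [Y. Liu, R. Pass, FOCS 2020,
proof of Thm 5.6] [cite: LiuPassFOCS2020, Thm 5.6 (proof)] -/
theorem mapEntropy_famEv {E : ℕ → Finset (List Bool)} (hE : ∀ n, (E n).Nonempty ∧ ∀ s ∈ E n, s.length = n)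
    (F : List Bool → List Bool) {γ₀ D c N ℓ : ℕ} (hFlen : ∀ s ∈ E (lpFamIn D N), (F s).length = ℓ)
    (hb : lpFamPad γ₀ D c N ≤ N - lpFamIn D N) :
    mapEntropy (famEv E D N) (famGen F γ₀ D c) = mapEntropy (E (lpFamIn D N)) F + lpFamPad γ₀ D c N := by
  have h1 : mapEntropy (famEv E D N) (famGen F γ₀ D c) =
      mapEntropy (famEv E D N) (padGenT F (lpFamIn D N) (lpFamPad γ₀ D c N)) :=
    mapEntropy_congr_fam fun x hx =>
      famGen_eq_padGenT F (γ₀ := γ₀) (D := D) (c := c) (N := N)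
        (length_of_mem_famEv (E := E) (D := D) (N := N) (fun n => (hE n).2) hx)
  rw [h1, famEv]
  exact mapEntropy_padGenT (hE _).1 (hE _).2 F hFlen hb

end Entropy

/-! ### The reduction: a distinguisher for the inner generator from one for the family -/

section Reduction

/-- The outer length selected by the coin count `C` at inner length `n`: `n^D + ⌊(C - A(n)) / K(n)⌋`
(the outer lengths sharing the inner length `n = 2^j` are `n^D ≤ N < (2n)^D`). [folklore] -/
def famOuter (D : ℕ) (A K : ℕ → ℕ) (n C : ℕ) : ℕ := n ^ D + (C - A n) / K n

/-- The coin count of the outer distinguisher selected by the coin count `C` at inner length `n`: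
`(C - A(n)) mod K(n)`. [folklore] -/
def famKap (A K : ℕ → ℕ) (n C : ℕ) : ℕ := (C - A n) % K n

variable (Dg : RandAlg (List Bool) Bool) (γ₀ D c : ℕ) (A K adv : ℕ → ℕ)

/-- **The reduction's distinguisher, deterministic core.** On input `⟨1ⁿ, y⟩` (an inner sample `y`,
`|y| = n + γ₀⌊log₂ n⌋`) with coins `r`: decode from the coin count `C = |r|` an outer length
`N = famOuter n C` and a coin count `κ = famKap n C`, pad the sample with the first `b(N)` coins and run
the outer distinguisher `Dg` on `⟨1^N, y ‖ r_{<b}⟩` with the last `κ` coins (print's reduction of the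
pseudorandomness of `G_γ` to that of `G'` in the proof of Thm 5.6, "it holds that `μ'(|s₁|) = 1/n²`",
made explicit; the advice — which of the polynomially many outer lengths over `n` is good for `Dg`,
and `Dg`'s coin count there — is carried by the coin count as for `lpAdvDist`).
[Y. Liu, R. Pass, FOCS 2020, proof of Thm 5.6, adapted to the tree's `RandAlg`/`UniversalMachine`
model] [cite: LiuPassFOCS2020, Thm 5.6 (proof)] -/
def famRedRun (z r : List Bool) : Bool :=
  Dg.run (boolPair (unaryEncodeNat (famOuter D A K (boolUnpair z).1.length r.length))
      ((boolUnpair z).2 ++ r.take (lpFamPad γ₀ D c (famOuter D A K (boolUnpair z).1.length r.length))))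
    (r.drop (r.length - famKap A K (boolUnpair z).1.length r.length))

/-- The coin count of the reduction at inner length `n` for the advice `adv(n) = i` (selecting the outer
length `N = n^D + i`): `A(n) + i · K(n) + (Dg's coin count on ⟨1^N, x⟩, |x| = N + 6⌊log₂ N⌋ - c)`.
[folklore] -/
def famRedCoins (n : ℕ) : ℕ :=
  A n + adv n * K n + Dg.coinLen (2 * (n ^ D + adv n) + 2 + lpFamLen c (n ^ D + adv n))

/-- **The reduction's distinguisher** `R = R_{Dg, γ₀, D, c, A, K, adv}` as a randomized algorithm: run
`famRedRun`; coin budget `famRedCoins (adv)` at the inner length read off the input length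
(`lpSeedOf (lpInner γ₀)`). [Y. Liu, R. Pass, FOCS 2020, proof of Thm 5.6, adapted to the tree's model]
[cite: LiuPassFOCS2020, Thm 5.6 (proof)] -/
noncomputable def famRedDist : RandAlg (List Bool) Bool where
  run := famRedRun Dg γ₀ D c A K
  coinLen Λ := famRedCoins Dg D c A K adv (lpSeedOf (lpInner γ₀) Λ)

/-- The coin budget of `R` on `⟨1ⁿ, y⟩`, `|y| = n + γ₀⌊log₂ n⌋`. [folklore] -/
theorem famRedDist_coinLen (n : ℕ) :
    (famRedDist Dg γ₀ D c A K adv).coinLen (2 * n + 2 + lpInner γ₀ n) = famRedCoins Dg D c A K adv n := by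
  simp only [famRedDist]
  rw [lpSeedOf_eq]
  intro n' hn'
  have := lpInner_mono γ₀ hn'.le
  omega

variable {Dg γ₀ D c A K adv}

/-- Decoding the outer length from the coin count. [folklore] -/
theorem famOuter_famRedCoins {n : ℕ}
    (hK : Dg.coinLen (2 * (n ^ D + adv n) + 2 + lpFamLen c (n ^ D + adv n)) < K n) :
    famOuter D A K n (famRedCoins Dg D c A K adv n) = n ^ D + adv n := by
  unfold famOuter famRedCoins
  have hK0 : 0 < K n := by omega
  rw [Nat.add_assoc, Nat.add_sub_cancel_left, Nat.add_comm (adv n * K n), Nat.add_mul_div_right _ _ hK0,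
    Nat.div_eq_of_lt hK, Nat.zero_add]

/-- Decoding `Dg`'s coin count from the coin count. [folklore] -/
theorem famKap_famRedCoins {n : ℕ}
    (hK : Dg.coinLen (2 * (n ^ D + adv n) + 2 + lpFamLen c (n ^ D + adv n)) < K n) :
    famKap A K n (famRedCoins Dg D c A K adv n) =
      Dg.coinLen (2 * (n ^ D + adv n) + 2 + lpFamLen c (n ^ D + adv n)) := by
  unfold famKap famRedCoins
  rw [Nat.add_assoc, Nat.add_sub_cancel_left, Nat.add_comm, Nat.add_mul_mod_self_right, Nat.mod_eq_of_lt hK]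

/-- The deterministic core on a well-formed input `⟨1ⁿ, y⟩`. [folklore] -/
@[simp] theorem famRedRun_boolPair (n : ℕ) (y r : List Bool) :
    famRedRun Dg γ₀ D c A K (boolPair (unaryEncodeNat n) y) r =
      Dg.run (boolPair (unaryEncodeNat (famOuter D A K n r.length))
          (y ++ r.take (lpFamPad γ₀ D c (famOuter D A K n r.length))))
        (r.drop (r.length - famKap A K n r.length)) := by
  simp [famRedRun]

/-- A sum over `{0,1}^m` is `2^m` times the uniform average. [folklore] -/
theorem sum_vector_eq_two_pow_mul_uniformAvg (m : ℕ) (f : List Bool → ℝ) :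
    ∑ x : List.Vector Bool m, f x.toList = 2 ^ m * uniformAvg m f := by
  unfold uniformAvg
  field_simp

/-- **Acceptance probability of the reduction**: on `⟨1ⁿ, y⟩`, `|y| = n + γ₀⌊log₂ n⌋`, with advice
`i = adv(n)` decodable (`K(n)` exceeds `Dg`'s coin count, the pad fits into `A(n)` coins) and the lengths
adding up, `Pr_r[R(1ⁿ, y; r) = 1] = E_{τ ← U_b}[Pr[Dg(1^N, y ‖ τ) = 1]]`, `N = n^D + i`: the padding
coins, the unused middle coins and `Dg`'s coins are independent uniform fields of the coin string.
[folklore] -/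
theorem famRedDist_pr_eq {n : ℕ} (y : List Bool) (hy : y.length = lpInner γ₀ n)
    (hK : Dg.coinLen (2 * (n ^ D + adv n) + 2 + lpFamLen c (n ^ D + adv n)) < K n)
    (hA : lpFamPad γ₀ D c (n ^ D + adv n) ≤ A n)
    (hsum : lpInner γ₀ n + lpFamPad γ₀ D c (n ^ D + adv n) = lpFamLen c (n ^ D + adv n)) :
    (famRedDist Dg γ₀ D c A K adv).pr id (boolPair (unaryEncodeNat n) y) {true} =
      uniformAvg (lpFamPad γ₀ D c (n ^ D + adv n)) fun τ =>
        Dg.pr id (boolPair (unaryEncodeNat (n ^ D + adv n)) (y ++ τ)) {true} := by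
  have hκC : (famRedDist Dg γ₀ D c A K adv).coinLen (id (boolPair (unaryEncodeNat n) y)).length =
      famRedCoins Dg D c A K adv n := by
    simp only [id, length_boolPair, length_unaryEncodeNat, hy]
    exact famRedDist_coinLen Dg γ₀ D c A K adv n
  rw [(famRedDist Dg γ₀ D c A K adv).pr_true_eq_uniformAvg id _ hκC]
  -- names
  set b := lpFamPad γ₀ D c (n ^ D + adv n) with hb
  set κ := Dg.coinLen (2 * (n ^ D + adv n) + 2 + lpFamLen c (n ^ D + adv n)) with hκ
  set mid := A n - b + adv n * K n with hmid
  have hCeq : famRedCoins Dg D c A K adv n = b + (mid + κ) := by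
    simp only [famRedCoins, hmid, hκ]
    omega
  -- the integrand on coin strings of the right length
  have hint : ∀ r : List Bool, r.length = famRedCoins Dg D c A K adv n →
      (if (famRedDist Dg γ₀ D c A K adv).run (boolPair (unaryEncodeNat n) y) r = true then (1 : ℝ) else 0) =
        (fun u w => if Dg.run (boolPair (unaryEncodeNat (n ^ D + adv n)) (y ++ u)) (w.drop mid) = true
            then (1 : ℝ) else 0) (r.take b) (r.drop b) := by
    intro r hr
    have hcand : famOuter D A K n r.length = n ^ D + adv n := by rw [hr]; exact famOuter_famRedCoins hK
    have hkap : famKap A K n r.length = κ := by rw [hr]; exact famKap_famRedCoins hK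
    have hdrop : (r.drop b).drop mid = r.drop (r.length - famKap A K n r.length) := by
      rw [List.drop_drop, hkap]
      congr 1
      omega
    simp only [famRedDist, famRedRun_boolPair, hcand, hdrop, ← hb]
  rw [uniformAvg_congr hint, hCeq,
    uniformAvg_add b _ (fun u w => if Dg.run (boolPair (unaryEncodeNat (n ^ D + adv n)) (y ++ u)) (w.drop mid) = true
      then (1 : ℝ) else 0)]
  refine uniformAvg_congr fun u hu => ?_
  rw [show (fun w : List Bool => if Dg.run (boolPair (unaryEncodeNat (n ^ D + adv n)) (y ++ u)) (w.drop mid) = true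
        then (1 : ℝ) else 0) =
      fun w => (fun (_ : List Bool) (ρ : List Bool) =>
        if Dg.run (boolPair (unaryEncodeNat (n ^ D + adv n)) (y ++ u)) ρ = true then (1 : ℝ) else 0)
        (w.take mid) (w.drop mid) from rfl,
    uniformAvg_add mid _ (fun (_ : List Bool) (ρ : List Bool) =>
        if Dg.run (boolPair (unaryEncodeNat (n ^ D + adv n)) (y ++ u)) ρ = true then (1 : ℝ) else 0),
    uniformAvg_const]
  symm
  refine Dg.pr_true_eq_uniformAvg id _ ?_
  simp only [id, length_boolPair, length_unaryEncodeNat, List.length_append, hy, hu, hκ]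
  congr 1
  omega

/-- **On the uniform ensemble**: `Pr[R(1ⁿ, U_{n + γ₀⌊log₂ n⌋}) = 1] = Pr[Dg(1^N, U_{N + 6⌊log₂ N⌋ - c}) = 1]`
(a uniform sample padded with uniform coins is uniform). [folklore] -/
theorem toReal_acceptPMF_famRedDist_uniform {n : ℕ}
    (hK : Dg.coinLen (2 * (n ^ D + adv n) + 2 + lpFamLen c (n ^ D + adv n)) < K n)
    (hA : lpFamPad γ₀ D c (n ^ D + adv n) ≤ A n)
    (hsum : lpInner γ₀ n + lpFamPad γ₀ D c (n ^ D + adv n) = lpFamLen c (n ^ D + adv n)) :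
    (acceptPMF (famRedDist Dg γ₀ D c A K adv) n (uniformBits (lpInner γ₀ n)) true).toReal =
      (acceptPMF Dg (n ^ D + adv n) (uniformBits (lpFamLen c (n ^ D + adv n))) true).toReal := by
  rw [toReal_acceptPMF_uniformBits, toReal_acceptPMF_uniformBits,
    uniformAvg_congr fun y hy => famRedDist_pr_eq (Dg := Dg) (γ₀ := γ₀) (D := D) (c := c) (A := A) (K := K)
      (adv := adv) y hy hK hA hsum, ← hsum,
    ← uniformAvg_add (lpInner γ₀ n) (lpFamPad γ₀ D c (n ^ D + adv n))
      (fun y τ => Dg.pr id (boolPair (unaryEncodeNat (n ^ D + adv n)) (y ++ τ)) {true})]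
  exact congr_arg (uniformAvg _) (funext fun x => by rw [List.take_append_drop])

/-- **On the generator ensemble**: `Pr[R(1ⁿ, F(U | S)) = 1] = Pr[Dg(1^N, G_c(U | S ‖ {0,1}^{N-n})) = 1]`
(the generator's output padded with uniform coins is the padded generator's output on a padded seed; the
ignored seed bits average out). [folklore] -/
theorem toReal_acceptPMF_famRedDist_gen {n : ℕ} {S : Finset (List Bool)} (hS : S.Nonempty)
    (hSlen : ∀ s ∈ S, s.length = n) (F : List Bool → List Bool) (hFlen : ∀ s ∈ S, (F s).length = lpInner γ₀ n)
    (hK : Dg.coinLen (2 * (n ^ D + adv n) + 2 + lpFamLen c (n ^ D + adv n)) < K n)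
    (hA : lpFamPad γ₀ D c (n ^ D + adv n) ≤ A n)
    (hsum : lpInner γ₀ n + lpFamPad γ₀ D c (n ^ D + adv n) = lpFamLen c (n ^ D + adv n))
    (hin : lpFamIn D (n ^ D + adv n) = n) (hb : lpFamPad γ₀ D c (n ^ D + adv n) ≤ n ^ D + adv n - n) :
    (acceptPMF (famRedDist Dg γ₀ D c A K adv) n ((condUniform S).map F) true).toReal =
      (acceptPMF Dg (n ^ D + adv n)
        ((condUniform (padSeeds S (n ^ D + adv n - n))).map (famGen F γ₀ D c)) true).toReal := by
  set g : List Bool → ℝ := fun x => Dg.pr id (boolPair (unaryEncodeNat (n ^ D + adv n)) x) {true} with hg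
  set b := lpFamPad γ₀ D c (n ^ D + adv n) with hb'
  have h2pos : (0 : ℝ) < 2 ^ (n ^ D + adv n - n) := by positivity
  have hSpos : (0 : ℝ) < S.card := by exact_mod_cast hS.card_pos
  rw [toReal_acceptPMF_condUniform_map _ n hS F,
    toReal_acceptPMF_condUniform_map _ (n ^ D + adv n) (padSeeds_nonempty hS _) _,
    card_padSeeds hSlen, sum_padSeeds hSlen,
    Finset.sum_congr rfl fun s hs => famRedDist_pr_eq (Dg := Dg) (γ₀ := γ₀) (D := D) (c := c) (A := A) (K := K)
      (adv := adv) (F s) (hFlen s hs) hK hA hsum]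
  have hinner : ∀ s ∈ S, ∑ σ : List.Vector Bool (n ^ D + adv n - n), g (famGen F γ₀ D c (s ++ σ.toList)) =
      2 ^ (n ^ D + adv n - n) * uniformAvg b (fun τ => g (F s ++ τ)) := by
    intro s hs
    have h1 : ∀ σ : List.Vector Bool (n ^ D + adv n - n),
        famGen F γ₀ D c (s ++ σ.toList) = F s ++ σ.toList.take b := fun σ =>
      famGen_append F (by rw [hin]; exact hSlen s hs) (by simp [hin])
    simp_rw [h1]
    rw [sum_vector_eq_two_pow_mul_uniformAvg (n ^ D + adv n - n) (fun σ => g (F s ++ σ.take b))]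
    congr 1
    have e : n ^ D + adv n - n = b + (n ^ D + adv n - n - b) := by omega
    rw [e]
    exact uniformAvg_take b _ (fun τ => g (F s ++ τ))
  rw [Finset.sum_congr rfl hinner, ← Finset.mul_sum]
  push_cast
  rw [mul_comm (S.card : ℝ), mul_div_mul_left _ _ h2pos.ne']

/-- **The reduction preserves the advantage**: at inner length `n` with good advice (outer length
`N = n^D + adv(n)` over `n`, lengths adding up, advice decodable), the advantage of `R` between
`F(U_n | E_n)` and `U_{n + γ₀⌊log₂ n⌋}` equals the advantage of `Dg` between `G_c(U_N | E^c_N)` and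
`U_{N + 6⌊log₂ N⌋ - c}`. [Y. Liu, R. Pass, FOCS 2020, proof of Thm 5.6 ("`μ'(|s₁|) = μ'(n^{1/2c₀}) =
1/n²`")] [cite: LiuPassFOCS2020, Thm 5.6 (proof)] -/
theorem distAdvantage_famRedDist_eq {F : List Bool → List Bool} {E : ℕ → Finset (List Bool)} {n : ℕ}
    (hE : ∀ n, (E n).Nonempty ∧ ∀ s ∈ E n, s.length = n)
    (hFlen : ∀ s ∈ E n, (F s).length = lpInner γ₀ n)
    (hK : Dg.coinLen (2 * (n ^ D + adv n) + 2 + lpFamLen c (n ^ D + adv n)) < K n)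
    (hA : lpFamPad γ₀ D c (n ^ D + adv n) ≤ A n)
    (hsum : lpInner γ₀ n + lpFamPad γ₀ D c (n ^ D + adv n) = lpFamLen c (n ^ D + adv n))
    (hin : lpFamIn D (n ^ D + adv n) = n) (hb : lpFamPad γ₀ D c (n ^ D + adv n) ≤ n ^ D + adv n - n) :
    distAdvantage (famRedDist Dg γ₀ D c A K adv) (condEnsemble F E) (uniformEnsemble (lpInner γ₀)) n =
      distAdvantage Dg (condEnsemble (famGen F γ₀ D c) (famEv E D)) (uniformEnsemble (lpFamLen c))
        (n ^ D + adv n) := by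
  unfold distAdvantage condEnsemble uniformEnsemble
  rw [toReal_acceptPMF_famRedDist_uniform hK hA hsum,
    toReal_acceptPMF_famRedDist_gen (hE n).1 (hE n).2 F hFlen hK hA hsum hin hb]
  simp only [famEv, hin]

end Reduction

/-! ### The efficiency facts -/

section Facts

/-- **Efficiency of the padded generators** (efficiency fact, D-0014). For every polynomial-time `F`
and all `γ₀, D, c`, the map `s ↦ F(s_{< n₁}) ‖ (s_{≥ n₁})_{< b}` (`famGen`) with `n₁ = 2^{⌊⌊log₂ |s|⌋/D⌋}`
(`lpFamIn`) and `b = |s| + 6⌊log₂ |s|⌋ - c - n₁ - γ₀⌊log₂ n₁⌋` (`lpFamPad`) is polynomial-time computable in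
the tree's TM2 sense: the length `|s|` in binary, an integer logarithm, a division by the constant `D`,
a power of two and the arithmetic of `b` on numbers of logarithmic length; `take`/`drop` at the computed
positions; one call to `F`; one concatenation. The tree has `PolyTimeComputable.comp_holds` and FP
bricks for these operations (`lenFn`, `logFn`, `divFn`, `twoPow`, `takeFn`, `dropFn`, `appendFn` in
`Literature.Computability.Complexity`); the assembly is not carried out here. [Y. Liu, R. Pass, FOCS 2020, Thm 5.6
("`G_γ` … running time `|s₀| + O(n^{1/2})`"), proof of Thm 5.5 ("`G'` finds a prefix … rewrites
`x' = x ‖ y`, and outputs `G(x) ‖ y`"); S. Arora, B. Barak, *Computational Complexity*, CUP 2009, §1.2–1.3]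
[cite: LiuPassFOCS2020, Thm 5.6 (proof)] -/
def famGen_polyTime : Prop :=
  ∀ F : List Bool → List Bool, PolyTimeComputable id id F →
    ∀ γ₀ D c : ℕ, PolyTimeComputable id id (famGen F γ₀ D c)

/-- **Efficiency of the reduction's distinguisher** (efficiency fact, D-0014). For every PPT `Dg`
(Boolean output), all `γ₀, D, c` and all polynomials `A, K`, the deterministic core
`(⟨1ⁿ, y⟩, r) ↦ famRedRun Dg γ₀ D c A K ⟨1ⁿ, y⟩ r` of `famRedDist` is polynomial-time computable in the
tree's TM2 sense: one `boolUnpair`; the arithmetic `A(n)`, `K(n)`, `|r|`, the division with remainder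
`|r| - A(n) = i · K(n) + κ`, `N = n^D + i` and `b(N)` (an integer logarithm, a division by `D`, a power of
two) on numbers of polynomial length; `1^N` in unary (`N ≤ n^D + |r|`, polynomial in the input
length); the list operations `y ‖ r_{<b}` and `r_{≥ |r| - κ}`; one call
`Dg.run` (polynomial time on *all* input/coin pairs, Gill-style `RandAlg.IsPolyTime`). Same status as
`lpAdvRun_polyTime` (proved in the tree from FP bricks, `LiuPassPaddingProofs.lean`).
[Y. Liu, R. Pass, FOCS 2020, proof of Thm 5.6; S. Arora, B. Barak, CUP 2009, Thm 1.9 and §7.1]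
[cite: LiuPassFOCS2020, Thm 5.6 (proof)] -/
def famRedRun_polyTime : Prop :=
  ∀ Dg : RandAlg (List Bool) Bool, IsPPT Dg encodeBool → ∀ (γ₀ D c : ℕ) (A K : Polynomial ℕ),
    PolyTimeComputable (fun p : List Bool × List Bool => boolPair p.1 p.2) encodeBool
      (Function.uncurry (famRedRun Dg γ₀ D c (fun n => A.eval n) (fun n => K.eval n)))

end Facts

/-! ### Pseudorandomness of the family by reduction to the inner generator -/

section Pseudorandomness

/-- Monotonicity of `ℕ`-polynomial evaluation in the argument (private copy, cf.
`LiuPassCondEPPRG.lean`). [folklore] -/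
private theorem natPoly_eval_mono (p : Polynomial ℕ) {a b : ℕ} (hab : a ≤ b) : p.eval a ≤ p.eval b := by
  rw [Polynomial.eval_eq_sum_range, Polynomial.eval_eq_sum_range]
  exact Finset.sum_le_sum fun i _ => Nat.mul_le_mul_left _ (Nat.pow_le_pow_left hab i)

/-- **`1/N²`-pseudorandomness of the family from `1/n^{δ₀}`-pseudorandomness of the inner generator**
(`δ₀ ≥ 3D`). If a PPT `Dg` had advantage `≥ 1/N²` between `G_c(U_N | E^c_N)` and `U_{N + 6⌊log₂ N⌋ - c}`
for infinitely many `N`, then infinitely many inner lengths `n` would carry such an `N` with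
`n^D ≤ N < (2n)^D`; with this `N` as advice the reduction `R` (`famRedDist`, PPT by `famRedRun_polyTime`
and a polynomial coin bound) has the same advantage (`distAdvantage_famRedDist_eq`) between
`F(U_n | E_n)` and `U_{n + γ₀⌊log₂ n⌋}`, and `1/N² > 1/n^{3D} ≥ 1/n^{δ₀}` since `N < (2n)^D ≤ n^{3D/2}`
(`n ≥ 4`) — contradicting the pseudorandomness of `F`. [Y. Liu, R. Pass, FOCS 2020, proof of Thm 5.6
("`μ'(|s₁|) = μ'(n^{1/2c₀}) = 1/n²`, so we conclude that `G_γ` is a … `μ`-cond EP-PRG")]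
[cite: LiuPassFOCS2020, Thm 5.6 (proof)] -/
theorem famGen_pseudorandom (hred : famRedRun_polyTime) {F : List Bool → List Bool}
    {E : ℕ → Finset (List Bool)} {γ₀ D c α₀ δ₀ : ℕ}
    (hF : IsCondEPPRG (fun n : ℕ => 1 / (n : ℝ) ^ δ₀) F E (lpInner γ₀) α₀) (hD : 1 ≤ D) (hδ : 3 * D ≤ δ₀)
    (hgood : ∀ᶠ N in atTop, lpInner γ₀ (lpFamIn D N) + lpFamPad γ₀ D c N = lpFamLen c N ∧
      lpFamPad γ₀ D c N ≤ N - lpFamIn D N)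
    (Dg : RandAlg (List Bool) Bool) (hDg : IsPPT Dg encodeBool) :
    ∀ᶠ N in atTop, distAdvantage Dg (condEnsemble (famGen F γ₀ D c) (famEv E D))
      (uniformEnsemble (lpFamLen c)) N < 1 / (N : ℝ) ^ 2 := by
  classical
  by_contra hnot
  rw [Filter.not_eventually] at hnot
  -- thresholds for the length bookkeeping
  obtain ⟨N₀, hN₀⟩ := Filter.eventually_atTop.1 hgood
  -- `Dg`'s coin polynomial and the advice moduli `A(n) = (2n)^D`, `K(n) = q(20 (2n)^D + 2) + 1`
  obtain ⟨q, hq⟩ := hDg.2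
  set Ap : Polynomial ℕ := (Polynomial.C 2 * Polynomial.X) ^ D with hAp
  set Kp : Polynomial ℕ := q.comp (Polynomial.C 20 * Ap + Polynomial.C 2) + 1 with hKp
  set A : ℕ → ℕ := fun n => Ap.eval n with hAdef
  set K : ℕ → ℕ := fun n => Kp.eval n with hKdef
  have hAeval : ∀ n, A n = (2 * n) ^ D := fun n => by simp [hAdef, hAp]
  have hKeval : ∀ n, K n = q.eval (20 * (2 * n) ^ D + 2) + 1 := fun n => by
    simp [hKdef, hKp, hAp, Polynomial.eval_comp]
  -- good outer lengths over the inner length `n`, and the advice selecting one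
  let good : ℕ → ℕ → Prop := fun n i => lpFamIn D (n ^ D + i) = n ∧ n ^ D + i < (2 * n) ^ D ∧ N₀ ≤ n ^ D + i ∧
    ¬ distAdvantage Dg (condEnsemble (famGen F γ₀ D c) (famEv E D)) (uniformEnsemble (lpFamLen c)) (n ^ D + i) <
      1 / ((n ^ D + i : ℕ) : ℝ) ^ 2
  obtain ⟨adv, hadv_spec, hadv_le⟩ : ∃ adv : ℕ → ℕ,
      (∀ n, (∃ i, good n i) → good n (adv n)) ∧ ∀ n, adv n ≤ (2 * n) ^ D := by
    refine ⟨fun n => if h : ∃ i, good n i then Nat.find h else 0, fun n h => ?_, fun n => ?_⟩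
    · simp only [dif_pos h]
      exact Nat.find_spec h
    · by_cases h : ∃ i, good n i
      · simp only [dif_pos h]
        have h1 := (Nat.find_spec h).2.1
        omega
      · simp only [dif_neg h]
        exact Nat.zero_le _
  -- sizes over the inner length `n`
  have hNle : ∀ n, n ^ D + adv n ≤ 2 * (2 * n) ^ D := fun n => by
    have h1 : n ^ D ≤ (2 * n) ^ D := Nat.pow_le_pow_left (by omega) D
    have := hadv_le n
    omega
  have hlenle : ∀ n, 2 * (n ^ D + adv n) + 2 + lpFamLen c (n ^ D + adv n) ≤ 20 * (2 * n) ^ D + 2 := fun n => by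
    have h1 := hNle n
    have h2 : lpFamLen c (n ^ D + adv n) ≤ 7 * (n ^ D + adv n) := by
      unfold lpFamLen
      have := Nat.log_le_self 2 (n ^ D + adv n)
      omega
    omega
  have hKbig : ∀ n, Dg.coinLen (2 * (n ^ D + adv n) + 2 + lpFamLen c (n ^ D + adv n)) < K n := fun n => by
    rw [hKeval]
    have := (hq _).trans (natPoly_eval_mono q (hlenle n))
    omega
  -- the reduction is PPT
  have hRppt : IsPPT (famRedDist Dg γ₀ D c A K adv) encodeBool := by
    refine ⟨hred Dg hDg γ₀ D c Ap Kp, Ap + Ap * Kp + Kp, fun Λ => ?_⟩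
    have hP : ∀ n, (Ap + Ap * Kp + Kp).eval n = A n + A n * K n + K n := fun n => by
      simp [hAdef, hKdef]
    set ns := lpSeedOf (lpInner γ₀) Λ with hns
    have hnsΛ : ns ≤ Λ := lpSeedOf_le _ _
    refine le_trans ?_ (natPoly_eval_mono _ hnsΛ)
    rw [hP]
    show famRedCoins Dg D c A K adv ns ≤ A ns + A ns * K ns + K ns
    unfold famRedCoins
    have h1 : adv ns * K ns ≤ A ns * K ns := Nat.mul_le_mul_right _ ((hadv_le ns).trans_eq (hAeval ns).symm)
    have h2 := (hKbig ns).le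
    omega
  -- pseudorandomness of the inner generator against the reduction
  have hpr := hF.pseudorandom hRppt
  -- infinitely many inner lengths carry a good outer length
  have hfreqn : ∃ᶠ n in atTop, ∃ i, good n i := by
    rw [Filter.frequently_atTop] at hnot ⊢
    intro n₀
    obtain ⟨N, hN, hbad⟩ := hnot (max (max N₀ 1) (2 ^ (D * n₀)))
    have hN1 : N ≠ 0 := by
      have : max (max N₀ 1) (2 ^ (D * n₀)) ≥ 1 := le_trans (le_max_right _ _) (le_max_left _ _)
      omega
    have hn₀ : n₀ ≤ lpFamIn D N := le_lpFamIn_of_pow_le hD (le_trans (le_max_right _ _) hN)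
    have hpow : lpFamIn D N ^ D ≤ N := lpFamIn_pow_le hN1
    have hNeq : lpFamIn D N ^ D + (N - lpFamIn D N ^ D) = N := by omega
    refine ⟨lpFamIn D N, hn₀, N - lpFamIn D N ^ D, ?_⟩
    show lpFamIn D (lpFamIn D N ^ D + (N - lpFamIn D N ^ D)) = lpFamIn D N ∧ _ ∧ _ ∧ _
    rw [hNeq]
    exact ⟨rfl, lt_two_mul_lpFamIn_pow hD hN1, le_trans (le_trans (le_max_left _ _) (le_max_left _ _)) hN, hbad⟩
  -- at a good inner length the reduction has the outer advantage, `≥ 1/N² ≥ 1/n^{δ₀}`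
  have hev : ∀ᶠ n in atTop, (∃ i, good n i) →
      1 / (n : ℝ) ^ δ₀ ≤ distAdvantage (famRedDist Dg γ₀ D c A K adv) (condEnsemble F E)
        (uniformEnsemble (lpInner γ₀)) n := by
    filter_upwards [eventually_ge_atTop 4, hF.length_out] with n hn4 hlen hex
    obtain ⟨hin, hlt, hN₀n, hbad⟩ := hadv_spec n hex
    obtain ⟨hsum, hb⟩ := hN₀ (n ^ D + adv n) hN₀n
    rw [hin] at hsum hb
    have hK := hKbig n
    have hA : lpFamPad γ₀ D c (n ^ D + adv n) ≤ A n := by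
      rw [hAeval]
      have : n ^ D + adv n - n ≤ n ^ D + adv n := Nat.sub_le _ _
      omega
    have hFlen : ∀ s ∈ E n, (F s).length = lpInner γ₀ n := fun s hs => hlen s (hF.length_eq hs)
    rw [distAdvantage_famRedDist_eq (Dg := Dg) (A := A) (K := K) (adv := adv) hF.2.1 hFlen hK hA hsum hin hb]
    refine le_trans ?_ (not_lt.1 hbad)
    have hn1 : 1 ≤ n := by omega
    have hNpos : 0 < n ^ D + adv n := by
      have : 1 ≤ n ^ D := Nat.one_le_pow _ _ (by omega)
      omega
    have hNR : (0 : ℝ) < ((n ^ D + adv n : ℕ) : ℝ) := by exact_mod_cast hNpos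
    refine one_div_le_one_div_of_le (by positivity) ?_
    -- `N² ≤ (2n)^{2D} = 4^D n^{2D} ≤ n^{3D} ≤ n^{δ₀}`
    have h1 : ((n ^ D + adv n : ℕ) : ℝ) ^ 2 ≤ (((2 * n) ^ D : ℕ) : ℝ) ^ 2 :=
      pow_le_pow_left₀ (by positivity) (by exact_mod_cast hlt.le) 2
    have h2 : (((2 * n) ^ D : ℕ) : ℝ) ^ 2 ≤ (n : ℝ) ^ (3 * D) := by
      have h4 : (4 : ℝ) ^ D ≤ (n : ℝ) ^ D := pow_le_pow_left₀ (by norm_num) (by exact_mod_cast hn4) D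
      have e1 : (((2 * n) ^ D : ℕ) : ℝ) ^ 2 = 4 ^ D * ((n : ℝ) ^ D) ^ 2 := by
        have h2n : ((2 * n) ^ D : ℕ) = 2 ^ D * n ^ D := mul_pow 2 n D
        have h22 : ((2 : ℝ) ^ D) ^ 2 = 4 ^ D := by rw [← pow_mul, mul_comm, pow_mul]; norm_num
        rw [h2n]
        push_cast
        rw [mul_pow, h22]
      have e2 : (n : ℝ) ^ (3 * D) = (n : ℝ) ^ D * ((n : ℝ) ^ D) ^ 2 := by ring
      rw [e1, e2]
      exact mul_le_mul_of_nonneg_right h4 (by positivity)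
    have h3 : (n : ℝ) ^ (3 * D) ≤ (n : ℝ) ^ δ₀ := pow_le_pow_right₀ (by exact_mod_cast hn1) hδ
    linarith
  obtain ⟨n, ⟨hex, himp⟩, hlt⟩ := ((hfreqn.and_eventually hev).and_eventually hpr).exists
  exact absurd ((himp hex).trans_lt hlt) (lt_irrefl _)

end Pseudorandomness

/-! ### Assembly: the covering family from the uniform Thm 5.5 and the efficiency facts -/

section Assembly

variable {U : UniversalMachine} {t : Polynomial ℕ}

/-- Every `ℕ`-polynomial is eventually dominated by a power: `P(x) ≤ x^d` for `x ≥ x₀`, some `d ≥ 1`.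
[folklore] -/
theorem exists_natPoly_eval_le_pow (P : Polynomial ℕ) : ∃ d : ℕ, 1 ≤ d ∧ ∃ x₀ : ℕ, ∀ x, x₀ ≤ x → P.eval x ≤ x ^ d := by
  refine ⟨P.natDegree + 1, by omega, max 1 (P.eval 1), fun x hx => ?_⟩
  have hx1 : 1 ≤ x := le_trans (le_max_left _ _) hx
  have h1 : P.eval x ≤ P.eval 1 * x ^ P.natDegree := by
    rw [Polynomial.eval_eq_sum_range, Polynomial.eval_eq_sum_range, Finset.sum_mul]
    refine Finset.sum_le_sum fun i hi => ?_
    rw [one_pow, mul_one]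
    rw [Finset.mem_range] at hi
    exact Nat.mul_le_mul_left _ (Nat.pow_le_pow_right hx1 (by omega))
  calc P.eval x ≤ P.eval 1 * x ^ P.natDegree := h1
    _ ≤ x * x ^ P.natDegree := Nat.mul_le_mul_right _ (le_trans (le_max_right _ _) hx)
    _ = x ^ (P.natDegree + 1) := by ring

/-- The arithmetic of print's eq. (2) in the tree's rendering: a program of length
`|hdr| + (n₁ + Ct) + b + (2|e| + 2)` with `|hdr| ≤ 2(⌊L/D⌋ + 1) + c_h`, `2⌊L/D⌋ ≤ L`, the lengths adding up
as `n₁ + 7D⌊L/D⌋ + b = N + 6L - c`, the inner stretch `7D⌊L/D⌋ ≥ 7L + 7 - 7D`, and `L` beyond the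
constants, witnesses `K^t + 3L < N + 6L - c`. [Y. Liu, R. Pass, FOCS 2020, proof of Thm 5.2, eq. (2)
("`K^t(G(s)) = n + O(1) ≤ m - γ/2 log n`")] [cite: LiuPassFOCS2020, Thm 5.2 (proof, eq. (2))] -/
theorem famKt_arith {K L Ld S7 D n₁ b hd Ct ce ch c N : ℕ}
    (hval : K ≤ hd + (n₁ + Ct) + b + ce) (hhd : hd ≤ 2 * (Ld + 1) + ch) (hLd : 2 * Ld ≤ L)
    (hsum : n₁ + S7 + b = N + 6 * L - c) (hS7 : 7 * L + 7 ≤ S7 + 7 * D)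
    (hLbig : ch + Ct + ce + 7 * D ≤ L) : K + 3 * L < N + 6 * L - c := by
  omega

/-- **Liu–Pass's Thm 5.6 with the truncations and eq. (2) of the proof of Thm 5.2, for the tree's
universal machine** — the named fact `condEPPRG_family_of_OWFExist` of `LiuPassCondEPPRG.lean` — **from
Thm 5.5 with its running-time clause** (`condEPPRG_uniform_of_OWFExist`), the pass-through fact
(`passThrough_polyTime`, proved in the tree) and the two efficiency facts `famGen_polyTime`,
`famRedRun_polyTime`. See the module docstring for the construction and the parameter bookkeeping:
`γ = 6`, entropy loss `α₀ + 2`, members `G_c = famGen F (7D) D c` for the member `F = Gu⟨1^{7D}, ⟨1^{3D}, ·⟩⟩`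
of the uniform family, `D = 2d` with `p(T(x)) ≤ x^d` the degree of `U`'s simulation of the pass-through
machine of `Gu`; output length (`eventually_famGood`), entropy (`mapEntropy_famEv`), pseudorandomness
(`famGen_pseudorandom`) and the `K^t` bound via `UniversalMachine.exists_ktAt_le_of_outputsWithin` at
budget `t(m) ≥ m ≥ N ≥ n₁^{2d} ≥ p(T(n₁ + O(1)))`. [Y. Liu, R. Pass, FOCS 2020, Thm 5.6 and its proof;
proof of Thm 5.2 (¶1 and eq. (2)); arXiv:2009.11514v1, §5.2–5.3]
[cite: LiuPassFOCS2020, Thm 5.6; Thm 5.2 (proof, ¶1 and eq. (2))] -/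
theorem condEPPRG_family_of_OWFExist_of_facts (h55 : condEPPRG_uniform_of_OWFExist)
    (hpass : passThrough_polyTime) (hgen : famGen_polyTime) (hred : famRedRun_polyTime) :
    condEPPRG_family_of_OWFExist := by
  classical
  intro hO U t ε hε ht
  obtain ⟨Gu, hGu, hfam⟩ := h55 hO
  -- the pass-through machine of `Gu`, its code and overhead on `U`, and their degree
  obtain ⟨hdr, ch, M, T, hhdr, hM⟩ := hpass Gu hGu
  obtain ⟨e, p, hsim⟩ := U.exists_ktAt_le_of_outputsWithin M
  obtain ⟨d, hd1, x₀, hdeg⟩ := exists_natPoly_eval_le_pow (p.comp T)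
  simp only [Polynomial.eval_comp] at hdeg
  -- the parameters and the inner generator
  obtain ⟨D, hD⟩ : ∃ D, D = 2 * d := ⟨_, rfl⟩
  have hD2 : 2 ≤ D := by omega
  have hD1 : 1 ≤ D := by omega
  obtain ⟨E, α₀, hF⟩ := hfam (7 * D) (3 * D) (by omega) (by omega)
  set F := lpTagged Gu (7 * D) (3 * D) with hFdef
  -- the tag overhead `|⟨1^{7D}, ⟨1^{3D}, s⟩⟩| = |s| + Ct`
  obtain ⟨Ct, hCt⟩ : ∃ Ct, Ct = 2 * (7 * D) + 2 + (2 * (3 * D) + 2) := ⟨_, rfl⟩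
  have hwlen : ∀ s : List Bool,
      (boolPair (unaryEncodeNat (7 * D)) (boolPair (unaryEncodeNat (3 * D)) s)).length = s.length + Ct := by
    intro s
    simp only [length_boolPair, length_unaryEncodeNat, hCt]
    omega
  -- `t(m) ≥ m`
  have htm : ∀ m : ℕ, m ≤ t.eval m := fun m => by
    have h1 := ht m
    have h0 : (0 : ℝ) ≤ m := Nat.cast_nonneg m
    have h2 : (m : ℝ) ≤ (1 + ε) * m := by nlinarith
    exact_mod_cast h2.trans h1
  refine ⟨6, α₀ + 2, fun c => famGen F (7 * D) D c, fun _ => famEv E D, by norm_num, fun c hc => ?_, fun c hc => ?_⟩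
  · -- ### the member `c` is a `1/N²`-cond EP-PRG of output length `N + 6⌊log₂ N⌋ - c`
    have hgoodc := eventually_famGood hD2 c
    refine ⟨hgen F hF.polyTimeComputable (7 * D) D c,
      fun N => ⟨famEv_nonempty hF.nonempty D N, fun s hs => length_of_mem_famEv (fun n s h => hF.length_eq h) hs⟩,
      ?_, ?_, ?_⟩
    · -- output length
      obtain ⟨n₀, hn₀⟩ := Filter.eventually_atTop.1 hF.length_out
      filter_upwards [hgoodc, eventually_le_lpFamIn hD1 n₀] with N hg hn s hs
      obtain ⟨hsum, hb, -, -⟩ := hg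
      have hn₁N := lpFamIn_le D N
      have h1 : (F (s.take (lpFamIn D N))).length = lpInner (7 * D) (lpFamIn D N) :=
        hn₀ _ hn _ (by rw [List.length_take]; omega)
      show (famGen F (7 * D) D c s).length = N + 6 * Nat.log 2 N - c
      rw [famGen, hs, List.length_append, h1, List.length_take, List.length_drop, hs, min_eq_left hb]
      exact hsum
    · -- pseudorandomness
      intro Dg hDg
      exact famGen_pseudorandom hred hF hD1 le_rfl (hgoodc.mono fun N h => ⟨h.1, h.2.1⟩) Dg hDg
    · -- entropy
      obtain ⟨n₀, hn₀⟩ := Filter.eventually_atTop.1 (hF.length_out.and hF.entropy)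
      filter_upwards [hgoodc, eventually_le_lpFamIn hD1 (max n₀ 1), eventually_ge_atTop 1] with N hg hn hN1
      obtain ⟨hsum, hb, -, hcL⟩ := hg
      have hN0 : N ≠ 0 := by omega
      have hn0' : n₀ ≤ lpFamIn D N := le_trans (le_max_left _ _) hn
      have hn1 : 1 ≤ lpFamIn D N := le_trans (le_max_right _ _) hn
      obtain ⟨hlen, hent⟩ := hn₀ (lpFamIn D N) hn0'
      have hFlen : ∀ s ∈ E (lpFamIn D N), (F s).length = lpInner (7 * D) (lpFamIn D N) := fun s hs =>
        hlen s (hF.length_eq hs)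
      rw [mapEntropy_famEv hF.2.1 F hFlen hb]
      -- `n₁ - α₀ log₂ n₁ + b ≥ N - (α₀ + 2) log₂ N`
      have hj : Nat.log 2 (lpFamIn D N) = Nat.log 2 N / D := log_lpFamIn hN0
      have hnN : lpFamIn D N ≤ N := lpFamIn_le D N
      have h7 : 7 * D * (Nat.log 2 N / D) ≤ 7 * Nat.log 2 N := by
        have := Nat.mul_div_le (Nat.log 2 N) D
        nlinarith
      have hbval : ((lpFamIn D N : ℕ) : ℝ) + (lpFamPad (7 * D) D c N : ℝ) + c + Nat.log 2 N ≥ (N : ℝ) := by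
        have h := hsum
        simp only [lpInner, hj, lpFamLen] at h
        have h' : N ≤ lpFamIn D N + lpFamPad (7 * D) D c N + c + Nat.log 2 N := by omega
        exact_mod_cast h'
      have hlogN : ((Nat.log 2 N : ℕ) : ℝ) ≤ Real.logb 2 N := by
        rw [Real.le_logb_iff_rpow_le one_lt_two (by exact_mod_cast Nat.pos_of_ne_zero hN0), Real.rpow_natCast]
        exact_mod_cast Nat.pow_log_le_self 2 hN0
      have hlogn : Real.logb 2 (lpFamIn D N) ≤ Real.logb 2 N :=
        Real.logb_le_logb_of_le one_lt_two (by exact_mod_cast hn1) (by exact_mod_cast hnN)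
      have hlogn0 : 0 ≤ Real.logb 2 (lpFamIn D N) := Real.logb_nonneg one_lt_two (by exact_mod_cast hn1)
      have hcR : (c : ℝ) ≤ Nat.log 2 N := by exact_mod_cast hcL
      have hα0 : (0 : ℝ) ≤ α₀ := Nat.cast_nonneg _
      have hαlog := mul_le_mul_of_nonneg_left hlogn hα0
      push_cast
      nlinarith [hent, hbval, hlogN, hlogn, hlogn0, hcR, hαlog]
  · -- ### low `K^t`-complexity of the outputs (print's eq. (2))
    obtain ⟨n₀, hn₀⟩ := Filter.eventually_atTop.1 hF.length_out
    have hgoodc := eventually_famGood hD2 c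
    filter_upwards [hgoodc, eventually_le_lpFamIn hD1 (n₀ + x₀ + Ct + 2),
      eventually_le_log (ch + Ct + (2 * e.length + 2) + 7 * D), eventually_ge_atTop 1] with N hg hn hLbig hN1 s hs
    obtain ⟨hsum, hb, -, -⟩ := hg
    have hN0 : N ≠ 0 := by omega
    have hnN : lpFamIn D N ≤ N := lpFamIn_le D N
    -- the blocks of the output
    have hs₁len : (s.take (lpFamIn D N)).length = lpFamIn D N := by rw [List.length_take]; omega
    have hτlen : ((s.drop (lpFamIn D N)).take (lpFamPad (7 * D) D c N)).length = lpFamPad (7 * D) D c N := by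
      rw [List.length_take, List.length_drop, hs]; exact min_eq_left hb
    have hGs : famGen F (7 * D) D c s =
        F (s.take (lpFamIn D N)) ++ (s.drop (lpFamIn D N)).take (lpFamPad (7 * D) D c N) := by
      simp [famGen, hs]
    set s₁ := s.take (lpFamIn D N) with hs₁
    set τ := (s.drop (lpFamIn D N)).take (lpFamPad (7 * D) D c N) with hτ
    set w := boolPair (unaryEncodeNat (7 * D)) (boolPair (unaryEncodeNat (3 * D)) s₁) with hw
    have hFs₁ : F s₁ = Gu w := rfl
    have hwl : w.length = lpFamIn D N + Ct := by rw [hw, hwlen, hs₁len]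
    have hFlen : (F s₁).length = lpInner (7 * D) (lpFamIn D N) := hn₀ _ (by omega) s₁ hs₁len
    have hout : (F s₁ ++ τ).length = lpFamLen c N := by rw [List.length_append, hFlen, hτlen]; exact hsum
    -- the budget `t(m) ≥ m ≥ N ≥ n₁^D ≥ p(T(n₁ + Ct))`
    have hbudget : p.eval (T.eval w.length) ≤ t.eval (F s₁ ++ τ).length := by
      rw [hout, hwl]
      refine le_trans ?_ (htm _)
      refine (hdeg _ (by omega)).trans ?_
      have h1 : (lpFamIn D N + Ct) ^ d ≤ (2 * lpFamIn D N) ^ d := Nat.pow_le_pow_left (by omega) d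
      have h2 : (2 * lpFamIn D N) ^ d ≤ lpFamIn D N ^ D := by
        have hDexp : lpFamIn D N ^ D = lpFamIn D N ^ d * lpFamIn D N ^ d := by
          rw [← pow_add]; congr 1; omega
        rw [mul_pow, hDexp]
        exact Nat.mul_le_mul_right _ (Nat.pow_le_pow_left (by omega) d)
      have h3 : lpFamIn D N ^ D ≤ N := lpFamIn_pow_le hN0
      have h4 : N ≤ lpFamLen c N := by unfold lpFamLen; omega
      exact h1.trans (h2.trans (h3.trans h4))
    -- the program `e ‖ (hdr ‖ w ‖ τ)` prints the output within the budget
    have hkt1 : U.ktAt (p.eval (T.eval w.length)) (F s₁ ++ τ) ≤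
        (((hdr w.length ++ w ++ τ).length + (2 * e.length + 2) : ℕ) : ℕ∞) := by
      have := hsim _ _ _ (hM w τ)
      rw [hFs₁]
      exact_mod_cast this
    have hval : liuPassKt U t (F s₁ ++ τ) ≤ (hdr w.length ++ w ++ τ).length + (2 * e.length + 2) := by
      rw [liuPassKt_def]
      exact ENat.toNat_le_of_le_coe ((U.ktAt_anti hbudget _).trans hkt1)
    -- arithmetic: `2 ⌊log₂ |w|⌋ + O(1) + 3L < 7D⌊L/D⌋ - (this is where the inner stretch pays)`
    show liuPassKt U t (famGen F (7 * D) D c s) + 3 * Nat.log 2 N < N + 6 * Nat.log 2 N - c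
    rw [hGs]
    have hhw := hhdr w.length
    have hlogw : Nat.log 2 w.length ≤ Nat.log 2 N / D + 1 := by
      rw [hwl]
      have hnpow : lpFamIn D N = 2 ^ (Nat.log 2 N / D) := lpFamIn_eq_pow hN0
      calc Nat.log 2 (lpFamIn D N + Ct) ≤ Nat.log 2 (2 ^ (Nat.log 2 N / D + 1)) :=
            Nat.log_mono_right (by rw [pow_succ]; omega)
        _ = Nat.log 2 N / D + 1 := Nat.log_pow one_lt_two _
    have hLd : 2 * (Nat.log 2 N / D) ≤ Nat.log 2 N :=
      (Nat.mul_le_mul_left 2 (Nat.div_le_div_left hD2 (by omega))).trans (Nat.mul_div_le _ 2)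
    have hdiv : Nat.log 2 N < D * (Nat.log 2 N / D) + D := by
      rw [mul_comm]
      exact Nat.lt_div_mul_add (show 0 < D by omega)
    have hS7 : 7 * Nat.log 2 N + 7 ≤ 7 * D * (Nat.log 2 N / D) + 7 * D := by
      have h := Nat.mul_le_mul_left 7 (Nat.succ_le_of_lt hdiv)
      have e1 : 7 * (D * (Nat.log 2 N / D) + D) = 7 * D * (Nat.log 2 N / D) + 7 * D := by ring
      omega
    have hhd : (hdr (lpFamIn D N + Ct)).length ≤ 2 * (Nat.log 2 N / D + 1) + ch := by
      rw [← hwl]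
      exact hhw.trans (by have := Nat.mul_le_mul_left 2 hlogw; omega)
    simp only [List.length_append, hwl, hτlen] at hval
    simp only [lpInner, log_lpFamIn hN0, lpFamLen] at hsum
    exact famKt_arith hval hhd hLd hsum hS7 hLbig

end Assembly

end Literature.Computability.Cryptography
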